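import Literature.Probability.Percolation.FiveArmUniqueness
import Literature.Probability.Percolation.FlipFourArm
import Literature.Probability.Percolation.LandedAltFourArm
import HarnessLib

/-!
# Five-arm sites with a landing sequence, II: the hexagon `Λ_N`, translation, and the free centre

Topic `Literature/Probability/Percolation`; family `crit-perc`. PROOFS ONLY (no named fact).
Complements to `FiveArmUniqueness.lean` (Nolin's "`A_v` can occur for at most one site `v`",
P. Nolin, EJP 13 (2008), §5.2, proof of Thm. 24 [arXiv 0711.4948: Thm. 23 (iii), pp. 16–17];
H. Kesten, V. Sidoravicius, Y. Zhang, EJP 3 (1998), proof of Lemma 5, (3.10)–(3.11)) in the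
conventions of the tree's hexagonal annuli (`armEvent`, `hexSide` of `LandedAltFourArm.lean`):

* `landingMeet_triBall_two`, `landingMeet_triBall_three` — inside `Λ_N = triBall N`, paths from
  side `0` to side `2` (resp. `3`) of `∂Λ_N` meet paths from side `4` to side `1`
  (`FourArmFlip.pathIn_arcs_meet`, Kesten 1982, §2.2);
* `hexSides N` — the landing sequence black → side `0`, white → side `4`, black → side `2`,
  black → side `3`, white → side `1` (around `∂Λ_N` the colours read `B, W, B, B, W`, Nolin's
  `σ = BWBBW`); `fiveArmLanding_triBall_unique`, `sum_real_fiveArmLanding_triBall_le_one` —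
  uniqueness and `Σ_v μ(A_v) ≤ 1` for `D = Λ_N`;
* `IsLandingArm.image`, `relabel_mem_fiveArmLanding`, `preimage_relabel_fiveArmLanding`,
  `real_fiveArmLanding_map` — transport of `A_v` along an automorphism of `𝕋` and invariance of
  `P_p` (`sitePercolation_real_preimage_relabel`), in particular under the translations
  `triShiftIso`: `real_fiveArmLanding_eq_shift` (`P_p(A_v(D, I)) = P_p(A_0(D - v, I - v))`) and
  the translated form `sum_real_fiveArmLanding_shift_le_one` of Nolin's display;
* `fiveArmLandingArms` (the arms without the colour of the centre),
  `fiveArmLanding_eq_inter`, `real_fiveArmLanding_eq_mul` — "`P_{1/2}(A_v) = ½ P(v ⇝^I ∂S_N)`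
  since the existence of the arms is independent of the status of `v`" (Nolin, p. 17), at density
  `p`: `P_p(A_v) = p · P_p(arms)`.

## References

* P. Nolin, Near-critical percolation in two dimensions, *Electron. J. Probab.* 13 (2008)
  1562–1623, §5.2, proof of Thm. 24 (arXiv 0711.4948: Thm. 23 (iii), pp. 16–17) [Nolin2008].
* H. Kesten, V. Sidoravicius, Y. Zhang, Almost all words are seen in critical site percolation on
  the triangular lattice, *Electron. J. Probab.* 3 (1998), proof of Lemma 5 [KestenSidoraviciusZhang1998].
* H. Kesten, *Percolation theory for mathematicians*, Birkhäuser (1982), §2.2 [KestenPTM1982].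

## Mathlib / tree

Tree: `fiveArmLanding`, `IsLandingArm`, `LandingMeet`, `fiveArmLanding_unique`,
`sum_real_fiveArmLanding_le_one`, `determinedBy_fiveArmLanding` (`FiveArmUniqueness.lean`),
`FourArmFlip.pathIn_arcs_meet` (`FlipFourArm.lean`), `hexSide`, `mem_hexSide_zero`,
`coord_of_mem_hexSide_one/three/four`, `triNorm_of_mem_hexSide` (`LandedAltFourArm.lean`),
`rot_apply_formula` (`ArmSeparationRotate.lean`), `pathIn_map_iso`, `triShiftIso`
(`TriRSWChaining.lean`, `TriSubcriticalCrossing.lean`), `SiteConfig.relabel`,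
`SiteConfig.mem_relabel_iff`, `sitePercolation_real_preimage_relabel`,
`sitePercolation_real_inter_of_disjoint`, `sitePercolation_real_mem`
(`SitePercolationMeasure.lean`), `determinedBy_iff` (`PercolationEvents.lean`).
-/

noncomputable section

open Set MeasureTheory

namespace Literature.Probability.Percolation

open LatticeModels

/-! ### The hexagon `Λ_N` -/

/-- Coordinates of side `2` of `∂Λ_R`: `x₁ = R` (and `-R ≤ x₀ ≤ 0`). [folklore] -/
theorem coord_of_mem_hexSide_two {R : ℕ} {z : Site 2} (hz : z ∈ hexSide R 2) :
    z 1 = R ∧ -(R : ℤ) ≤ z 0 ∧ z 0 ≤ 0 := by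
  obtain ⟨s, ⟨h0, h1, h2⟩, rfl⟩ := mem_hexSide_iff.1 hz
  obtain ⟨-, -, -, -, r20, r21, -⟩ := rot_apply_formula s
  rw [r20, r21]; omega

/-- **Inside `Λ_N`, paths from side `0` to side `2` meet paths from side `4` to side `1`**
(Kesten 1982, §2.2, in the hexagon: `FourArmFlip.pathIn_arcs_meet`). [cite: KestenPTM1982, §2.2 (paths crossing a rectangle must intersect)] -/
theorem landingMeet_triBall_two (N : ℕ) :
    LandingMeet ↑(triBall N) (hexSide N 0) (hexSide N 2) (hexSide N 4) (hexSide N 1) := by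
  intro A A' a b c d hA hA' ha hb hc hd hP hQ
  have hAN : ∀ z ∈ A, triNorm z ≤ N := fun z hz => mem_triBall_iff.1 (Finset.mem_coe.1 (hA hz))
  have hA'N : ∀ z ∈ A', triNorm z ≤ N := fun z hz => mem_triBall_iff.1 (Finset.mem_coe.1 (hA' hz))
  obtain ⟨z, hzA', hzA⟩ := FourArmFlip.pathIn_arcs_meet hA'N hAN hQ (coord_of_mem_hexSide_four hc).1
    (triNorm_of_mem_hexSide hc) (coord_of_mem_hexSide_one hd).1 (triNorm_of_mem_hexSide hd) hP
    (mem_hexSide_zero.1 ha).1 (triNorm_of_mem_hexSide ha)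
    (Or.inl ⟨(coord_of_mem_hexSide_two hb).1, (coord_of_mem_hexSide_two hb).2.2⟩)
    (triNorm_of_mem_hexSide hb)
  exact ⟨z, hzA, hzA'⟩

/-- **Inside `Λ_N`, paths from side `0` to side `3` meet paths from side `4` to side `1`**
(Kesten 1982, §2.2, in the hexagon: `FourArmFlip.pathIn_arcs_meet`). [cite: KestenPTM1982, §2.2 (paths crossing a rectangle must intersect)] -/
theorem landingMeet_triBall_three (N : ℕ) :
    LandingMeet ↑(triBall N) (hexSide N 0) (hexSide N 3) (hexSide N 4) (hexSide N 1) := by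
  intro A A' a b c d hA hA' ha hb hc hd hP hQ
  have hAN : ∀ z ∈ A, triNorm z ≤ N := fun z hz => mem_triBall_iff.1 (Finset.mem_coe.1 (hA hz))
  have hA'N : ∀ z ∈ A', triNorm z ≤ N := fun z hz => mem_triBall_iff.1 (Finset.mem_coe.1 (hA' hz))
  obtain ⟨z, hzA', hzA⟩ := FourArmFlip.pathIn_arcs_meet hA'N hAN hQ (coord_of_mem_hexSide_four hc).1
    (triNorm_of_mem_hexSide hc) (coord_of_mem_hexSide_one hd).1 (triNorm_of_mem_hexSide hd) hP
    (mem_hexSide_zero.1 ha).1 (triNorm_of_mem_hexSide ha)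
    (Or.inr (coord_of_mem_hexSide_three hb).1) (triNorm_of_mem_hexSide hb)
  exact ⟨z, hzA, hzA'⟩

/-- **The landing sequence on `∂Λ_N`**: black → side `0`, white → side `4`, black → side `2`,
black → side `3`, white → side `1` (side `5` unused). Around `∂Λ_N` the sides `0, 1, 2, 3, 4`
carry the colours `B, W, B, B, W`: Nolin's `σ = BWBBW` with its landing sequence `I₁, …, I₅` in
cyclic order. [cite: Nolin2008, §5.2, proof of Thm. 24 (arXiv 0711.4948: p. 16, "the particular landing sequence I₁, …, I₅")] -/
def hexSides (N : ℕ) : Fin 5 → Set (Site 2) :=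
  ![hexSide N 0, hexSide N 4, hexSide N 2, hexSide N 3, hexSide N 1]

/-- **Uniqueness in the hexagon**: two black sites of `Λ_N` carrying five pairwise disjoint arms
inside `Λ_N` — black to side `0`, white to side `4`, black to side `2`, black to side `3`, white to
side `1` — coincide. [cite: Nolin2008, §5.2, proof of Thm. 24 (arXiv 0711.4948: p. 17, "A_v can occur for at most one site v")] -/
theorem fiveArmLanding_triBall_unique {N : ℕ} {ω : SiteConfig (Site 2)} {v w : Site 2}
    (hv : ω ∈ fiveArmLanding ↑(triBall N) (hexSides N) v)
    (hw : ω ∈ fiveArmLanding ↑(triBall N) (hexSides N) w) : v = w :=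
  fiveArmLanding_unique (landingMeet_triBall_two N) (landingMeet_triBall_three N) hv hw

/-- **`Σ_v μ(A_v) ≤ 1` in the hexagon**, for every probability measure `μ` on the site
configurations (every density) and every finite set `V` of centres. [cite: Nolin2008, §5.2, proof of Thm. 24 (arXiv 0711.4948: p. 17, first display)] [cite: KestenSidoraviciusZhang1998, proof of Lemma 5, (3.11)] -/
theorem sum_real_fiveArmLanding_triBall_le_one (μ : Measure (SiteConfig (Site 2)))
    [IsProbabilityMeasure μ] (N : ℕ) (V : Finset (Site 2)) :
    ∑ v ∈ V, μ.real (fiveArmLanding ↑(triBall N) (hexSides N) v) ≤ 1 :=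
  sum_real_fiveArmLanding_le_one μ (triBall N) (I := hexSides N) (landingMeet_triBall_two N)
    (landingMeet_triBall_three N) V

/-! ### Transport along automorphisms of `𝕋`; translations -/

section Transport

variable (φ : triGraph ≃g triGraph)

/-- A landing arm is carried to a landing arm by an automorphism `φ` of `𝕋` acting on the
configuration (`SiteConfig.relabel`), the region, the landing area and the centre. [folklore] -/
theorem IsLandingArm.image {ω : SiteConfig (Site 2)} {D I S : Set (Site 2)} {v : Site 2} {c : Bool}
    (h : IsLandingArm ω D I v c S) :
    IsLandingArm (SiteConfig.relabel φ.toEquiv ω) (φ '' D) (φ '' I) (φ v) c (φ '' S) := by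
  obtain ⟨hsub, hnot, hcol, a, b, ha, hva, hb, hconn⟩ := h
  refine ⟨image_mono hsub, ?_, ?_, φ a, φ b, mem_image_of_mem _ ha, φ.map_adj_iff.2 hva,
    mem_image_of_mem _ hb, ?_⟩
  · rintro ⟨z, hz, hzv⟩
    exact hnot ((φ.injective hzv) ▸ hz)
  · rintro _ ⟨z, hz, rfl⟩
    rw [← hcol z hz, SiteConfig.mem_relabel_iff]
    exact iff_of_eq (congrArg (· ∈ ω) (φ.toEquiv.symm_apply_apply z))
  · rintro _ ⟨z, hz, rfl⟩
    exact pathIn_map_iso φ (hconn z hz)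

/-- `A_v` is carried to `A_{φ v}` (region and landing areas transported). [folklore] -/
theorem relabel_mem_fiveArmLanding {ω : SiteConfig (Site 2)} {D : Set (Site 2)}
    {I : Fin 5 → Set (Site 2)} {v : Site 2} (h : ω ∈ fiveArmLanding D I v) :
    SiteConfig.relabel φ.toEquiv ω ∈ fiveArmLanding (φ '' D) (fun i => φ '' I i) (φ v) := by
  obtain ⟨hvD, hvω, S, hS, hdisj⟩ := h
  refine ⟨mem_image_of_mem _ hvD, ?_, fun i => φ '' S i, fun i => (hS i).image φ, ?_⟩
  · rw [SiteConfig.mem_relabel_iff]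
    exact (congrArg (· ∈ ω) (φ.toEquiv.symm_apply_apply v)).mpr hvω
  · intro i j hij
    exact (disjoint_image_iff φ.injective).2 (hdisj hij)

/-- The preimage of the transported event is the event. [folklore] -/
theorem preimage_relabel_fiveArmLanding (D : Set (Site 2)) (I : Fin 5 → Set (Site 2)) (v : Site 2) :
    SiteConfig.relabel φ.toEquiv ⁻¹' fiveArmLanding (φ '' D) (fun i => φ '' I i) (φ v) =
      fiveArmLanding D I v := by
  ext ω
  refine ⟨fun h => ?_, fun h => relabel_mem_fiveArmLanding φ h⟩
  have h' := relabel_mem_fiveArmLanding φ.symm h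
  have e1 : SiteConfig.relabel φ.symm.toEquiv (SiteConfig.relabel φ.toEquiv ω) = ω := by
    ext z
    rw [SiteConfig.mem_relabel_iff, SiteConfig.mem_relabel_iff]
    exact iff_of_eq (congrArg (· ∈ ω) (φ.toEquiv.symm_apply_apply z))
  have e2 : ∀ X : Set (Site 2), φ.symm '' (φ '' X) = X := fun X => by
    rw [← image_comp]; convert image_id X; ext z; simp
  have e3 : φ.symm (φ v) = v := by simp
  simpa only [e1, e2, e3] using h'

/-- **`P_p` is invariant under the transport of `A_v`**: `P_p(A_{φ v}(φ D, φ I)) = P_p(A_v(D, I))`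
for every automorphism `φ` of `𝕋` and every density `p`. [folklore] -/
theorem real_fiveArmLanding_map (p : unitInterval) (D : Set (Site 2)) (I : Fin 5 → Set (Site 2))
    (v : Site 2) :
    (triSitePercolation p).real (fiveArmLanding (φ '' D) (fun i => φ '' I i) (φ v)) =
      (triSitePercolation p).real (fiveArmLanding D I v) := by
  rw [← preimage_relabel_fiveArmLanding φ D I v]
  exact (sitePercolation_real_preimage_relabel φ.toEquiv p _).symm

end Transport

/-- **Translation invariance**: `P_p(A_v(D, I)) = P_p(A_0(D - v, I - v))` — the probability that
`v` is a landed five-arm site of the box `D` is the probability that the origin is one of the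
translated box `D - v` (Nolin: "the different sites in `S_{N/2}`"; the comparison of these
probabilities across `v`, Nolin's "`P(A_v) ≍ P(0 ⇝^{5,σ} ∂S_N)`", is NOT claimed: it needs arm
separation). [cite: Nolin2008, §5.2, proof of Thm. 24 (arXiv 0711.4948: p. 16, "uniformly in N, v ∈ S_{N/2}")] -/
theorem real_fiveArmLanding_eq_shift (p : unitInterval) (D : Set (Site 2)) (I : Fin 5 → Set (Site 2))
    (v : Site 2) :
    (triSitePercolation p).real (fiveArmLanding D I v) =
      (triSitePercolation p).real
        (fiveArmLanding (triShiftIso (-v) '' D) (fun i => triShiftIso (-v) '' I i) 0) := by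
  have h := real_fiveArmLanding_map (triShiftIso (-v)) p D I v
  have h0 : (triShiftIso (-v)) v = 0 := by simp
  rw [h0] at h
  exact h.symm

/-- **Nolin's display, translated**: for the box `D` (finite) with its landing areas as in
`fiveArmLanding_unique` and every finite set `V` of centres,
`Σ_{v ∈ V} P_p(A_0(D - v, I - v)) ≤ 1` at every density `p`. [cite: Nolin2008, §5.2, proof of Thm. 24 (arXiv 0711.4948: p. 17, first display)] [cite: KestenSidoraviciusZhang1998, proof of Lemma 5, (3.11)] -/
theorem sum_real_fiveArmLanding_shift_le_one (p : unitInterval) (D : Finset (Site 2))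
    {I : Fin 5 → Set (Site 2)} (hmeet₂ : LandingMeet ↑D (I 0) (I 2) (I 1) (I 4))
    (hmeet₃ : LandingMeet ↑D (I 0) (I 3) (I 1) (I 4)) (V : Finset (Site 2)) :
    ∑ v ∈ V, (triSitePercolation p).real
        (fiveArmLanding (triShiftIso (-v) '' ↑D) (fun i => triShiftIso (-v) '' I i) 0) ≤ 1 := by
  calc ∑ v ∈ V, (triSitePercolation p).real
        (fiveArmLanding (triShiftIso (-v) '' ↑D) (fun i => triShiftIso (-v) '' I i) 0)
      = ∑ v ∈ V, (triSitePercolation p).real (fiveArmLanding ↑D I v) :=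
        Finset.sum_congr rfl fun v _ => (real_fiveArmLanding_eq_shift p ↑D I v).symm
    _ ≤ 1 := sum_real_fiveArmLanding_le_one _ D hmeet₂ hmeet₃ V

/-! ### The colour of the centre is free -/

/-- The arms of `A_v` without the condition on the colour of the centre: Nolin's
`{v ⇝^I_{5,σ} ∂S_N}`, KSZ's `F(w, n)`. [cite: Nolin2008, §5.2, proof of Thm. 24 (arXiv 0711.4948: p. 16, the event A_v)] [cite: KestenSidoraviciusZhang1998, proof of Lemma 5, (3.10)] -/
def fiveArmLandingArms (D : Set (Site 2)) (I : Fin 5 → Set (Site 2)) (v : Site 2) :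
    Set (SiteConfig (Site 2)) :=
  {ω | v ∈ D ∧ ∃ S : Fin 5 → Set (Site 2),
    (∀ i, IsLandingArm ω D (I i) v (nolinFive i) (S i)) ∧ Pairwise fun i j => Disjoint (S i) (S j)}

/-- `A_v = {v black} ∩ {arms}`. [cite: Nolin2008, §5.2, proof of Thm. 24 (arXiv 0711.4948: p. 16, the event A_v)] -/
theorem fiveArmLanding_eq_inter (D : Set (Site 2)) (I : Fin 5 → Set (Site 2)) (v : Site 2) :
    fiveArmLanding D I v = {ω | v ∈ ω} ∩ fiveArmLandingArms D I v := by
  ext ω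
  simp only [fiveArmLanding, fiveArmLandingArms, mem_inter_iff, mem_setOf_eq]
  tauto

/-- The arms only look at the sites of `D` other than the centre ("the existence of the arms is
independent of the status of `v`", Nolin, p. 17). [cite: Nolin2008, §5.2, proof of Thm. 24 (arXiv 0711.4948: p. 17)] -/
theorem determinedBy_fiveArmLandingArms (D : Set (Site 2)) (I : Fin 5 → Set (Site 2)) (v : Site 2) :
    DeterminedBy (fiveArmLandingArms D I v) (D \ {v}) := by
  rw [determinedBy_iff]
  suffices key : ∀ ω ω' : Set (Site 2), ω ∩ (D \ {v}) = ω' ∩ (D \ {v}) →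
      ω ∈ fiveArmLandingArms D I v → ω' ∈ fiveArmLandingArms D I v from
    fun ω ω' h => ⟨key ω ω' h, key ω' ω h.symm⟩
  intro ω ω' h ⟨hvD, S, hS, hdisj⟩
  have agree : ∀ z ∈ D \ {v}, z ∈ ω ↔ z ∈ ω' := fun z hz => by
    constructor
    · intro hzω; exact ((Set.ext_iff.1 h z).1 ⟨hzω, hz⟩).1
    · intro hzω; exact ((Set.ext_iff.1 h z).2 ⟨hzω, hz⟩).1
  refine ⟨hvD, S, fun i => ?_, hdisj⟩
  obtain ⟨hsub, hnot, hcol, hrest⟩ := hS i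
  refine ⟨hsub, hnot, fun z hz => ?_, hrest⟩
  have hz' : z ∈ D \ {v} := ⟨hsub hz, fun hzv => hnot (mem_singleton_iff.1 hzv ▸ hz)⟩
  exact (agree z hz').symm.trans (hcol z hz)

/-- The colour of one site only looks at that site. [folklore] -/
theorem determinedBy_setOf_mem_site (v : Site 2) :
    DeterminedBy {ω : SiteConfig (Site 2) | v ∈ ω} ({v} : Set (Site 2)) := by
  rw [determinedBy_iff]
  intro ω ω' h
  simp only [mem_setOf_eq]
  constructor
  · intro hv; exact ((Set.ext_iff.1 h v).1 ⟨hv, rfl⟩).1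
  · intro hv; exact ((Set.ext_iff.1 h v).2 ⟨hv, rfl⟩).1

/-- **The colour of the centre is free**: `P_p(A_v) = p · P_p(arms)` for a finite box `D` (Nolin,
p. 17: "`P_{1/2}(A_v) = ½ P(v ⇝^I_{5,σ} ∂S_N)` since the existence of the arms is independent of
the status of `v`"; KSZ, (3.11): "`Σ_w P{w is occupied and F(w, n)} = ½ Σ_w P{F(w, n)}`"). [cite: Nolin2008, §5.2, proof of Thm. 24 (arXiv 0711.4948: p. 17)] [cite: KestenSidoraviciusZhang1998, proof of Lemma 5, (3.11)] -/
theorem real_fiveArmLanding_eq_mul (p : unitInterval) (D : Finset (Site 2)) (I : Fin 5 → Set (Site 2))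
    (v : Site 2) :
    (triSitePercolation p).real (fiveArmLanding ↑D I v) =
      p * (triSitePercolation p).real (fiveArmLandingArms ↑D I v) := by
  classical
  rw [fiveArmLanding_eq_inter, triSitePercolation]
  have hA : DeterminedBy {ω : SiteConfig (Site 2) | v ∈ ω} ↑({v} : Finset (Site 2)) := by
    rw [Finset.coe_singleton]; exact determinedBy_setOf_mem_site v
  have hB : DeterminedBy (fiveArmLandingArms ↑D I v) ↑(D.erase v) := by
    rw [Finset.coe_erase]; exact determinedBy_fiveArmLandingArms ↑D I v
  rw [sitePercolation_real_inter_of_disjoint p hA hB (by simp), sitePercolation_real_mem]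

/-- Hence **`Σ_v P_p(arms at v) ≤ 1/p`**, e.g. `Σ_{v} P_{1/2}(v ⇝^I_{5,σ} ∂S_N) ≤ 2` (KSZ,
(3.11); Nolin, p. 17), for a finite box with landing areas as in `fiveArmLanding_unique`. [cite: KestenSidoraviciusZhang1998, proof of Lemma 5, (3.11)] [cite: Nolin2008, §5.2, proof of Thm. 24 (arXiv 0711.4948: p. 17, first display)] -/
theorem mul_sum_real_fiveArmLandingArms_le_one (p : unitInterval) (D : Finset (Site 2))
    {I : Fin 5 → Set (Site 2)} (hmeet₂ : LandingMeet ↑D (I 0) (I 2) (I 1) (I 4))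
    (hmeet₃ : LandingMeet ↑D (I 0) (I 3) (I 1) (I 4)) (V : Finset (Site 2)) :
    (p : ℝ) * ∑ v ∈ V, (triSitePercolation p).real (fiveArmLandingArms ↑D I v) ≤ 1 := by
  rw [Finset.mul_sum]
  calc ∑ v ∈ V, (p : ℝ) * (triSitePercolation p).real (fiveArmLandingArms ↑D I v)
      = ∑ v ∈ V, (triSitePercolation p).real (fiveArmLanding ↑D I v) :=
        Finset.sum_congr rfl fun v _ => (real_fiveArmLanding_eq_mul p D I v).symm
    _ ≤ 1 := sum_real_fiveArmLanding_le_one _ D hmeet₂ hmeet₃ V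

end Literature.Probability.Percolation
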